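import Mathlib
import Summits.KontsevichZagierPeriods.Zeta5Search.WedgeDictionaryRowsB
import Summits.KontsevichZagierPeriods.Zeta5Search.Elimination.DictPencilFull
import HarnessLib

/-!
# Wedge dictionary (gen-1): the D2 terminal programme with BOTH dictionary nodes discharged BY NAME (gen-1 g19)

HONEST FRAMING: systematic search; no irrationality claim unless certified.  An implication between displayed statements about
gen-1's period dictionary; nothing about the size of linear forms and nothing about the irrationality of ζ(5).

OUR work (Summit side; cell `pub-zeta5`, lineage gen-1; the dictionary theorems are fam-elim g25's).  The capstone of LEAN FILING REQUEST
gen-1 #12, `Rows.explicitPQ_of_data4'` (`WedgeDictionaryRowsB`), derives gen-1's wedge conjecture `explicitPQ` from the three CELLULAR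
relation families `CellStar`, `CellPencil`, `CellBridge`, the two DICTIONARY nodes `DictStar`, `DictPencil`, the Brown–Zudilin invariance
`invariance_of_converges'` and gen-1's exact data at four level-1 points.  fam-elim g25 proved both dictionary nodes outright:
`Elimination.dictStar_holds : DictStar` (`Elimination/DictStarTop`, the gauge-free STAR from gen-1's four-term relation + S₇ transport) and
`Elimination.dictPencil_holds : DictPencil` (`Elimination/DictPencilFull`, PENCIL(a,i) = PENCIL(a,k) + STAR(P;i,k)).  Substituting them:

**`Rows.explicitPQ_of_cells4`** — `explicitPQ` follows from `CellStar`, `CellPencil`, `CellBridge`, `invariance_of_converges'` and the data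
`ExplicitPQAt` at `(1,0,1,0,1,1,1,1; j=1)`, `(0,0,1,0,1,1,1,1; 2)`, `(0,0,1,0,1,0,0,1; 2)`, `(0,0,1,0,1,1,0,1; 2)` — i.e. the dictionary side
of the D2 terminal programme is CLOSED in the kernel; what remains displayed is cellular (three `@[conjecture]` relation families among
Brown–Zudilin cellular integrals), the published invariance, and four exact values of gen-1's computation.

**`Rows.explicitPQ_iff_cells4`** — conversely `explicitPQ` gives the three cellular families (`cellStar_of_explicitPQ'`, `cellPencil_of_explicitPQ'`
(fam-elim), `cellBridge_of_explicitPQ'` (p293432 chain)) and its own four instances (`explicitPQ_iff_at`; the four `RegionHyp`s by `decide`), so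
UNDER the Brown–Zudilin invariance gen-1's wedge conjecture is EQUIVALENT to the three cellular relation families plus four level-1 values.

What this is NOT: no proof of `CellStar` / `CellPencil` / `CellBridge` (analytic identities among integrals), of `invariance_of_converges'`
(Brown–Zudilin), or of the four data values; nothing about ζ(5).
-/

noncomputable section

namespace Summit.KontsevichZagierPeriods.Zeta5Search.WedgeDictionary.Rows

open Summit.KontsevichZagierPeriods.Zeta5Search.WedgeDictionary
open Summit.KontsevichZagierPeriods.Zeta5Search.Elimination (dictStar_holds dictPencil_holds cellStar_of_explicitPQ'
  cellPencil_of_explicitPQ' cellBridge_of_explicitPQ')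
open Literature.NumberTheory.Irrationality.BrownZudilin2022 (invariance_of_converges')

/-- **D2 terminal programme, dictionary side closed**: gen-1's wedge conjecture `explicitPQ` from the three cellular relation families,
the Brown–Zudilin invariance and gen-1's exact data at four level-1 points (`explicitPQ_of_data4'` with fam-elim's `dictStar_holds`,
`dictPencil_holds`). -/
theorem explicitPQ_of_cells4 (hcS : CellStar) (hcP : CellPencil) (hcB : CellBridge) (hInv : invariance_of_converges')
    (D1 : ExplicitPQAt ![1, 0, 1, 0, 1, 1, 1, 1] 1) (D2 : ExplicitPQAt ![0, 0, 1, 0, 1, 1, 1, 1] 2)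
    (D16 : ExplicitPQAt ![0, 0, 1, 0, 1, 0, 0, 1] 2) (D17 : ExplicitPQAt ![0, 0, 1, 0, 1, 1, 0, 1] 2) : explicitPQ :=
  explicitPQ_of_data4' hcS dictStar_holds hcP dictPencil_holds hcB hInv D1 D2 D16 D17

/-- **The D2 end statement.**  Under the Brown–Zudilin invariance `invariance_of_converges'`, gen-1's wedge conjecture `explicitPQ` is
EQUIVALENT to the conjunction of the three cellular relation families `CellStar`, `CellPencil`, `CellBridge` and its four level-1 instances. -/
theorem explicitPQ_iff_cells4 (hInv : invariance_of_converges') :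
    explicitPQ ↔
      (CellStar ∧ CellPencil ∧ CellBridge ∧ ExplicitPQAt ![1, 0, 1, 0, 1, 1, 1, 1] 1 ∧ ExplicitPQAt ![0, 0, 1, 0, 1, 1, 1, 1] 2 ∧
        ExplicitPQAt ![0, 0, 1, 0, 1, 0, 0, 1] 2 ∧ ExplicitPQAt ![0, 0, 1, 0, 1, 1, 0, 1] 2) :=
  ⟨fun h => ⟨cellStar_of_explicitPQ' h, cellPencil_of_explicitPQ' h, cellBridge_of_explicitPQ' h,
      explicitPQ_iff_at.1 h _ _ (by unfold RegionHyp; decide), explicitPQ_iff_at.1 h _ _ (by unfold RegionHyp; decide),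
      explicitPQ_iff_at.1 h _ _ (by unfold RegionHyp; decide), explicitPQ_iff_at.1 h _ _ (by unfold RegionHyp; decide)⟩,
    fun h => explicitPQ_of_cells4 h.1 h.2.1 h.2.2.1 hInv h.2.2.2.1 h.2.2.2.2.1 h.2.2.2.2.2.1 h.2.2.2.2.2.2⟩

end Summit.KontsevichZagierPeriods.Zeta5Search.WedgeDictionary.Rows

end
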